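import Summits.QuantumFields.YangMills.Theorems.BalabanUVNodesN22GenAnalyticReadingRoad1Direct

/-!
# BalabanUVNodes ∕ node N22 = NE9 — ROAD 1 AT THE RECORD FROM THE ANALYTIC READING READ DIRECTLY, CLAUSE `max(ω₁, 4M_b c_w∕ϱ) ≤ ℓ.ω`: K3's `h9`, the kernel-face socket and the
# pin face from the analytic reading of node00-def-W1's one-step map in the older terms + the first-order last-coupling schema + (Adm-run) — NO node-N18 letter, NO second order,
# NO output bound; module J61's sum clause `ω₁ + 4M_b c_w∕ϱ ≤ ℓ.ω` replaced by `ω₁ ≤ μ`, `4M_b c_w∕ϱ ≤ μ`, `μ ≤ ℓ.ω`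

Cell `pub-ymgap`, HUMAN RULING D-0062 (Track A), R134 seat `pub-ymgap-dag-n22-c` (strategy s1), generation 18, module J65.  THEOREMS ONLY (no `def`, no `sorry`, standard axioms);
`--kind proof --supports stmt-QuantumFields-27366 --as helper` (K3⁸ `SpineGivenEndpointR13SepCoPHV`), COUNT-NEUTRAL.  Imports module J64 `…N22GenAnalyticReadingRoad1Direct` (through it
J56, J55's `table_le_moduli_of_rows`, dag-n22-w5's `AtRecordOfPrintedSlots.ne9_EA_objectsOfRecord₁₃_of_outputCoordLetters`, dag-n22-w3's socket ∕ pin forms).  Nothing re-declared;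
§1 is J56 §1's proof with the letters supplied by J64 §2, §2–§3 one application of §1 each.

WHY.  Module J61 = ROAD 1 from (AR) via the sum-channel recursion, clause `ω₁ + 4M_b c_w∕ϱ ≤ ℓ.ω` (pub-balaban's `fade_of_radius` in the record's letters).  Module J64 reads (AR)
DIRECTLY and gets the letters `ℓ₁ μ^{age}` for any `μ ≥ max(ω₁, 4M_b c_w∕ϱ)`; THIS FILE feeds them to dag-n22-w5's J36-at-record exactly as J56 does: inputs (AR) at rate `κ_E ≥ κ` with age
weights `0 ≤ aw K k j ≤ c_w·ω₁^{k−j}`, the LAST-coupling schema (G-T1-last) (`lam ≤ ℓ₁`), (Adm-run), term holomorphy through the readings ∕ chart ∕ space clause ∕ tails at the run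
towers, W1-20's law, (1.21), rows **`ω₁ ≤ μ`, `4M_b c_w∕ϱ ≤ μ`, `μ ≤ ℓ.ω`**, `ℓ.κ ≤ δ₁`, `(16B₃²∕r²)e^{12Mδ₁}K₀K₁·ℓ₁ ≤ ℓ.C₉·ℓ.ω` ⟹ §1 ★★★ `ne9_EA_objectsOfRecord₁₃_of_genAnalyticReadingRoad1Max`
(K3's `h9`), §2 ★★★ `n22At_u3OfRecord₁₃_of_genAnalyticReadingRoad1Max` (dag-n27-c's `h22` row), §3 ★★★ `n22At_rateCarriers_of_kernels_pin_of_genAnalyticReadingRoad1Max` (pin face).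
THE N22 ROW SENTENCE on this road: «an analytic reading of def-W1's one-step map whose age contraction `ω₁` AND margin ratio `4M_b c_w∕ϱ` are EACH below the record's fading ratio `ω`
+ first-order regularity in the last coupling + generated runs admissible + readings ∕ tails ∕ law ∕ (1.21) ⇒ §2b `h9` ∕ `N22At` — no N18, no second order, no output bound».

HONEST FRAMING (binding).  Count-neutral COMPOSITION; every input a DISPLAYED HYPOTHESIS ((AR) = the cell's reading of [II] (2.14)–(2.15) p. 15 for the older terms as independent
variables — GAPS G-ne9p2-5; the clause is the END OF RECORD's N2 shape, not printed; producer: node N10 ∕ NODE A on def-T's generator of record; inhabited by every generator ignoring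
`(z, old)` within the output bound — A5, conditional content); NO estimate of Bałaban's is proved or asserted; nothing of the record is constructed or claimed to meet the displayed
inputs.  N22 is NOT discharged (typed 28∕28 · discharged 5∕27 UNCHANGED); K3⁸ OPEN and NOT claimed (no stub of 27366 touched); NE9 is NOT IN PRINT for d = 4; no count claim; one
finite 𝕋⁴ programme at fixed ε — R4 closes the CONDITIONAL rung `BalabanLadder.UV` only; NOTHING about the continuum limit, ℝ⁴, infinite volume, OS axioms, a mass gap or the Clay
problem is proved or claimed.  References (TYPES only): [I] = Bałaban, CMP 109 (1987) (0.23) p. 256, (1.7) p. 261, §1 p. 263, (1.20)–(1.22) p. 264, (2.12)–(2.13) p. 268, p. 282,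
(4.35)–(4.37) pp. 290–291, §5 p. 298; [II] = CMP 116 (1988) (1.41) p. 11, (2.13)–(2.15) pp. 14–15, p. 18.
-/

noncomputable section

open Set Metric
open scoped BigOperators

namespace YMDAG.N22.KernelFading

open Literature.MathematicalPhysics.QuantumFieldTheory.Balaban1983to89
open Literature.MathematicalPhysics.QuantumFieldTheory.Balaban1983to89.T4Continuum (T4Family ULoop)
open Literature.MathematicalPhysics.QuantumFieldTheory.Balaban1983to89.T4OutputRate (Window NE9)
open Literature.MathematicalPhysics.QuantumFieldTheory.Balaban1983to89.TreeLengthTorus (TPt)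
open Literature.MathematicalPhysics.QuantumFieldTheory.Balaban1983to89.B12TreeDecay (K₀ kappa₀)
open Literature.MathematicalPhysics.QuantumFieldTheory.Balaban1983to89.B12Decay510 (delta1)
open Literature.MathematicalPhysics.QuantumFieldTheory.Balaban1983to89.B12Decay510Window (K₁)
open Literature.MathematicalPhysics.QuantumFieldTheory.Balaban1983to89.B12Decay510Torus (distCT nearT)
open Literature.MathematicalPhysics.QuantumFieldTheory.Balaban1983to89.Node00 (Stage13Params Stage13HParams U3Letters₁₁ MatA)
open Literature.MathematicalPhysics.QuantumFieldTheory.Balaban1983to89.Node00.Sect2 (domSys domCount CPair)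
open Literature.MathematicalPhysics.QuantumFieldTheory.Balaban1983to89.Node00.W1
open Literature.MathematicalPhysics.QuantumFieldTheory.Balaban1983to89.Node00.LocalizedSum17 (ReadingMaps Localizes17OfRecord₁₃)
open Literature.MathematicalPhysics.QuantumFieldTheory.Balaban1983to89.Node00.U3OfKernels (histPrefix objectsOfRecord₁₃)
open Literature.MathematicalPhysics.QuantumFieldTheory.Balaban1983to89.Node00.U3KernelLetters (PolLimitsExistOfRecord₁₃)
open YMDAG.UVSplit (N22At u3OfRecord₁₃ RateReading₁₃CoPH rateCarriersOfRecord₁₃CoPH)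
open YMDAG.N22.AtKernels (n22At_rateCarriers_of_kernels_pin_of_ne9 n22At_u3OfRecord₁₃_objectsOfRecord₁₃_iff)
open YMDAG.N22.AtRecordOfPrintedSlots (ne9_EA_objectsOfRecord₁₃_of_outputCoordLetters)
open YMDAG.N22.TermRecursion (coordLetter_box_truncRun_toClusterTower_of_analyticReading table_le_moduli_of_rows)

open scoped Matrix.Norms.L2Operator

variable (F : T4Family) (N : ℕ) [NeZero N] {𝔸 : Type} {M : ℕ}

/-! ## §1 ★★★ K3's `h9` on ROAD 1 from the analytic reading read directly, clause `max(ω₁, 4M_b c_w∕ϱ) ≤ ℓ.ω` -/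

open Classical Finset in
/-- ★★★ **K3's `h9` ON ROAD 1 FROM THE ANALYTIC READING READ DIRECTLY — CLAUSE `ω₁ ≤ μ`, `4M_b c_w∕ϱ ≤ μ`, `μ ≤ ℓ.ω`.**  (AR) in the older terms at rate `κ_E` with age weights
`aw K k j ≤ c_w·ω₁^{k−j}` + the first-order LAST-coupling schema (`lam ≤ ℓ₁`) + (Adm-run) + term holomorphy through the readings ∕ chart ∕ space clause ∕ tails at the run towers + W1-20's
law + (1.21) + rows `ω₁ ≤ μ`, `4M_b c_w∕ϱ ≤ μ`, `μ ≤ ℓ.ω`, `ℓ.κ ≤ δ₁`, `(16B₃²∕r²)e^{12Mδ₁}K₀K₁·ℓ₁ ≤ ℓ.C₉·ℓ.ω` ⟹ **`NE9 ((objectsOfRecord₁₃ F N θ ℓ).EA 0) (Window θ.γ) ℓ.κ ℓ.moduli`** —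
module J64 §2 per torus (rate lowered `κ_E → κ`) into dag-n22-w5's `ne9_EA_objectsOfRecord₁₃_of_outputCoordLetters` with `Λt n i = ℓ₁ μ^{n−1−i}` and J55's `table_le_moduli_of_rows`.
LOCATED (hypothesis form); N22 NOT discharged. [folklore] -/
theorem ne9_EA_objectsOfRecord₁₃_of_genAnalyticReadingRoad1Max (θ : Stage13Params F N) (ℓ : U3Letters₁₁) (hs : ℓ.Signs) (hγ : 0 < θ.γ) (hlim : PolLimitsExistOfRecord₁₃ F N θ)
    (m' : ℕ) (M : ℕ) [NeZero M] (hM : M = F.L ^ m')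
    (Gn : (K : ℕ) → GenTower (F.P K) 𝔸 M) (emb : ReadingMaps F (MatA N) 𝔸)
    (hloc : Localizes17OfRecord₁₃ F N θ (fun K => truncRun K (toClusterTower (Gn K))) emb)
    (sp : (K k : ℕ) → (domSys (F.P K) M (k + 1)).Dom → Set (CPair (F.P K) 𝔸))
    {κ κE δ₀ B₃ r ℓ₁ R r₀ ϱ Mb cw ω₁ μ : ℝ} {lam : ℕ → ℕ → ℝ} {aw : ℕ → ℕ → ℕ → ℝ}
    (hκ₀ : kappa₀ (4 * 2 ^ 4) (2 * 4) ≤ κ / 2) (hδ₀ : 0 < δ₀) (hB₃ : 0 ≤ B₃) (hr : 0 < r) (hκE : κ ≤ κE)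
    (Adm : (K k : ℕ) → OlderTerms (F.P K) 𝔸 M k → Prop)
    (hAdm : ∀ K, ∀ g ∈ Window θ.γ, ∀ k, Adm K k (olderOf (recTerm (Gn K) fun n => ((g n : ℝ) : ℂ)) k))
    {Pot : ℕ → ℕ → Type*} [∀ K k, NormedAddCommGroup (Pot K k)] [∀ K k, NormedSpace ℂ (Pot K k)]
    (ρA : (K k : ℕ) → OlderTerms (F.P K) 𝔸 M k → Pot K k) (A : (K k : ℕ) → ℝ → CPair (F.P K) 𝔸 → (domSys (F.P K) M (k + 1)).Dom → Pot K k → ℂ)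
    (hGA : ∀ (K k : ℕ), ∀ t ∈ Ioc (0 : ℝ) θ.γ, ∀ (old : OlderTerms (F.P K) 𝔸 M k), Adm K k old → ∀ (X : (domSys (F.P K) M (k + 1)).Dom), ∀ φ ∈ sp K k X,
      ((Gn K) k).E ((t : ℝ) : ℂ) old φ X = A K k t φ X (ρA K k old))
    (hA : ∀ (K k : ℕ), ∀ t ∈ Ioc (0 : ℝ) θ.γ, ∀ (X : (domSys (F.P K) M (k + 1)).Dom), ∀ φ ∈ sp K k X, DifferentiableOn ℂ (A K k t φ X) (ball 0 R))
    (hMbA : ∀ (K k : ℕ), ∀ t ∈ Ioc (0 : ℝ) θ.γ, ∀ (X : (domSys (F.P K) M (k + 1)).Dom), ∀ φ ∈ sp K k X, ∀ p ∈ ball (0 : Pot K k) R,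
      ‖A K k t φ X p‖ ≤ Mb * Real.exp (-(κE * (domSys (F.P K) M (k + 1)).dj X)))
    (hAdmr : ∀ (K k : ℕ) (old : OlderTerms (F.P K) 𝔸 M k), Adm K k old → ‖ρA K k old‖ ≤ r₀)
    (hρ₁ : ∀ (K k : ℕ) (o o' : OlderTerms (F.P K) 𝔸 M k), Adm K k o → Adm K k o' → ∀ (B' : ℝ), 0 ≤ B' →
      (∀ (k' : ℕ) (hk' : k' < k) (Y : (domSys (F.P K) M (k' + 1)).Dom), ∀ φ' ∈ sp K k' Y,
        aw K k (k' + 1) * (Real.exp (κE * (domSys (F.P K) M (k' + 1)).dj Y) * ‖o ⟨k' + 1, Nat.succ_lt_succ hk'⟩ Y φ' - o' ⟨k' + 1, Nat.succ_lt_succ hk'⟩ Y φ'‖) ≤ B') →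
      ‖ρA K k o - ρA K k o'‖ ≤ B')
    (haw : ∀ K k j, 0 ≤ aw K k j) (hawω : ∀ K k j, j ≤ k → aw K k j ≤ cw * ω₁ ^ (k - j)) (hcw : 0 ≤ cw) (hϱ : 0 < ϱ) (hR : r₀ + ϱ < R)
    (hGt : ∀ (K k : ℕ), ∀ t ∈ Ioc (0 : ℝ) θ.γ, ∀ t' ∈ Ioc (0 : ℝ) θ.γ, ∀ (old : OlderTerms (F.P K) 𝔸 M k), Adm K k old → ∀ (X : (domSys (F.P K) M (k + 1)).Dom), ∀ φ ∈ sp K k X,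
      ‖((Gn K) k).E ((t : ℝ) : ℂ) old φ X - ((Gn K) k).E ((t' : ℝ) : ℂ) old φ X‖ ≤ Real.exp (-(κE * (domSys (F.P K) M (k + 1)).dj X)) * (lam K k * |t - t'|))
    (hlam : ∀ K k, lam K k ≤ ℓ₁) (hℓ₁ : 0 ≤ ℓ₁) (hω₁ : 0 ≤ ω₁)
    (Ec : ℕ → ℕ → Type*) [∀ K k, NormedAddCommGroup (Ec K k)] [∀ K k, NormedSpace ℂ (Ec K k)]
    (ι : letI := θ.instVβ₁; letI := θ.instVβ₂
      (K k : ℕ) → (domSys (F.P K) M (k + 1)).Dom → ((Fin (F.P K).d → Site (F.P K) (k + 1) → θ.Vβ) →L[ℝ] Ec K k))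
    (Φ : (K k : ℕ) → (domSys (F.P K) M (k + 1)).Dom → Ec K k → CPair (F.P K) 𝔸)
    (U : (K k : ℕ) → (domSys (F.P K) M (k + 1)).Dom → Set (Ec K k)) (hU : ∀ K k X, IsOpen (U K k X)) (hrU : ∀ K k X, ball (0 : Ec K k) r ⊆ U K k X)
    (hEhol : ∀ g ∈ Window θ.γ, ∀ (K k : ℕ) (X : (domSys (F.P K) M (k + 1)).Dom),
      DifferentiableOn ℂ (fun z => (truncRun K (toClusterTower (Gn K)) k).E (histPrefix g k) (Φ K k X z) X) (U K k X))
    (hΦemb : letI := θ.instVβ₁; letI := θ.instVβ₂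
      ∀ (K k : ℕ) (X : (domSys (F.P K) M (k + 1)).Dom) (Bf : Fin (F.P K).d → Site (F.P K) (k + 1) → θ.Vβ),
        Φ K k X (ι K k X Bf) = emb K k (fun l t => NormedSpace.exp (θ.ρ8 (Bf l t))))
    (hΦsp : ∀ (K k : ℕ) (X : (domSys (F.P K) M (k + 1)).Dom), ∀ z ∈ ball (0 : Ec K k) r, Φ K k X z ∈ sp K k X)
    (w : (K k : ℕ) → (domSys (F.P K) M (k + 1)).Dom → Site (F.P K) (k + 1) → ℝ) (hw₀ : ∀ K k X t, 0 ≤ w K k X t)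
    (hw : letI := θ.instVβ₁; letI := θ.instVβ₂; letI := θ.instιβ
      ∀ (K k : ℕ) (X : (domSys (F.P K) M (k + 1)).Dom) (l : Fin (F.P K).d) (t : Site (F.P K) (k + 1)) (c : θ.ιβ),
        ‖ι K k X (Pi.single l (Pi.single t (θ.bV c)))‖ ≤ w K k X t)
    (htail : ∀ (K k : ℕ) (X : (domSys (F.P K) M (k + 1)).Dom) (t : Site (F.P K) (k + 1)),
      let e : Site (F.P K) (k + 1) → TPt 4 (domCount (F.P K) M (k + 1) * M) := fun x i => (ZMod.cast (x i) : ZMod (domCount (F.P K) M (k + 1) * M))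
      w K k X t ≤ B₃ * Real.exp (-δ₀ * distCT (domCount (F.P K) M (k + 1)) M (e t) (nearT (M := M) (e t) X)))
    (hω₁μ : ω₁ ≤ μ) (hCμ : 4 * Mb * cw / ϱ ≤ μ) (hμω : μ ≤ ℓ.ω) (hℓκ : ℓ.κ ≤ delta1 δ₀ κ ((M : ℝ) * 4))
    (hrow : 16 * B₃ ^ 2 / r ^ 2 * Real.exp (delta1 δ₀ κ ((M : ℝ) * 4) * ((M : ℝ) * 4) * 3) * K₀ (4 * 2 ^ 4) (2 * 4) * K₁ 4 (δ₀ / 2) * ℓ₁ ≤ ℓ.C₉ * ℓ.ω) :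
    NE9 ((objectsOfRecord₁₃ F N θ ℓ).EA 0) (Window θ.γ) ℓ.κ ℓ.moduli := by
  -- module J64 at every torus: the per-coordinate letters `ℓ₁ μ^{age}` read DIRECTLY from the analytic reading (rate `κE`, lowered to `κ`)
  have hμ0 : 0 ≤ μ := hω₁.trans hω₁μ
  have hlet : ∀ (K k : ℕ), ∀ g ∈ box θ.γ k, ∀ (i : Fin (k + 1)), ∀ t ∈ Ioc (0 : ℝ) θ.γ, ∀ (X : (domSys (F.P K) M (k + 1)).Dom), ∀ φ ∈ sp K k X,
      ‖(truncRun K (toClusterTower (Gn K)) k).E g φ X - (truncRun K (toClusterTower (Gn K)) k).E (Function.update g i t) φ X‖ ≤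
        (fun n i : ℕ => ℓ₁ * μ ^ (n - 1 - i)) (k + 1) i * Real.exp (-(κ * (domSys (F.P K) M (k + 1)).dj X)) * |g i - t| := by
    intro K k g hg i t ht X φ hφ
    have h := coordLetter_box_truncRun_toClusterTower_of_analyticReading (Gn K) (sp K) (Adm K) (ρA K) (A K) hγ hϱ hR (hGA K) (hA K) (hMbA K) (hAdmr K) (hρ₁ K) (haw K)
      (hawω K) hcw hω₁ (hAdm K) (hGt K) (hlam K) hℓ₁ hω₁μ hCμ K k g hg i t ht X φ hφ
    have hd : 0 ≤ (domSys (F.P K) M (k + 1)).dj X := (domSys (F.P K) M (k + 1)).dj_nonneg X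
    have hexp : Real.exp (-(κE * (domSys (F.P K) M (k + 1)).dj X)) ≤ Real.exp (-(κ * (domSys (F.P K) M (k + 1)).dj X)) :=
      Real.exp_le_exp.mpr (by nlinarith)
    have hℓμ : 0 ≤ ℓ₁ * μ ^ (k - (i : ℕ)) := by positivity
    show _ ≤ ℓ₁ * μ ^ (k + 1 - 1 - (i : ℕ)) * Real.exp (-(κ * (domSys (F.P K) M (k + 1)).dj X)) * |g i - t|
    rw [Nat.add_sub_cancel]
    exact h.trans (mul_le_mul_of_nonneg_right (mul_le_mul_of_nonneg_left hexp hℓμ) (abs_nonneg _))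
  exact ne9_EA_objectsOfRecord₁₃_of_outputCoordLetters F N θ ℓ hs hlim m' M hM (fun K => truncRun K (toClusterTower (Gn K))) emb hloc sp
    (fun n i => ℓ₁ * μ ^ (n - 1 - i)) (fun n i => by positivity) hκ₀ hδ₀ hB₃ hr hlet Ec ι Φ U hU hrU hEhol hΦemb hΦsp w hw₀ hw htail hℓκ
    (table_le_moduli_of_rows ℓ hs hμ0 hμω hrow)

/-! ## §2 ★★★ The kernel-face socket -/

open Classical Finset in
/-- ★★★ **THE KERNEL-FACE SOCKET ON ROAD 1, MAX CLAUSE** — §1's inputs ⟹ **`N22At (u3OfRecord₁₃ θ (objectsOfRecord₁₃ F N θ ℓ) k)` for EVERY run length `k`** (dag-n27-c's `h22` row).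
LOCATED (hypothesis form); N22 NOT discharged. [folklore] -/
theorem n22At_u3OfRecord₁₃_of_genAnalyticReadingRoad1Max (θ : Stage13Params F N) (ℓ : U3Letters₁₁) (hs : ℓ.Signs) (hγ : 0 < θ.γ) (hlim : PolLimitsExistOfRecord₁₃ F N θ)
    (m' : ℕ) (M : ℕ) [NeZero M] (hM : M = F.L ^ m')
    (Gn : (K : ℕ) → GenTower (F.P K) 𝔸 M) (emb : ReadingMaps F (MatA N) 𝔸)
    (hloc : Localizes17OfRecord₁₃ F N θ (fun K => truncRun K (toClusterTower (Gn K))) emb)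
    (sp : (K k : ℕ) → (domSys (F.P K) M (k + 1)).Dom → Set (CPair (F.P K) 𝔸))
    {κ κE δ₀ B₃ r ℓ₁ R r₀ ϱ Mb cw ω₁ μ : ℝ} {lam : ℕ → ℕ → ℝ} {aw : ℕ → ℕ → ℕ → ℝ}
    (hκ₀ : kappa₀ (4 * 2 ^ 4) (2 * 4) ≤ κ / 2) (hδ₀ : 0 < δ₀) (hB₃ : 0 ≤ B₃) (hr : 0 < r) (hκE : κ ≤ κE)
    (Adm : (K k : ℕ) → OlderTerms (F.P K) 𝔸 M k → Prop)
    (hAdm : ∀ K, ∀ g ∈ Window θ.γ, ∀ k, Adm K k (olderOf (recTerm (Gn K) fun n => ((g n : ℝ) : ℂ)) k))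
    {Pot : ℕ → ℕ → Type*} [∀ K k, NormedAddCommGroup (Pot K k)] [∀ K k, NormedSpace ℂ (Pot K k)]
    (ρA : (K k : ℕ) → OlderTerms (F.P K) 𝔸 M k → Pot K k) (A : (K k : ℕ) → ℝ → CPair (F.P K) 𝔸 → (domSys (F.P K) M (k + 1)).Dom → Pot K k → ℂ)
    (hGA : ∀ (K k : ℕ), ∀ t ∈ Ioc (0 : ℝ) θ.γ, ∀ (old : OlderTerms (F.P K) 𝔸 M k), Adm K k old → ∀ (X : (domSys (F.P K) M (k + 1)).Dom), ∀ φ ∈ sp K k X,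
      ((Gn K) k).E ((t : ℝ) : ℂ) old φ X = A K k t φ X (ρA K k old))
    (hA : ∀ (K k : ℕ), ∀ t ∈ Ioc (0 : ℝ) θ.γ, ∀ (X : (domSys (F.P K) M (k + 1)).Dom), ∀ φ ∈ sp K k X, DifferentiableOn ℂ (A K k t φ X) (ball 0 R))
    (hMbA : ∀ (K k : ℕ), ∀ t ∈ Ioc (0 : ℝ) θ.γ, ∀ (X : (domSys (F.P K) M (k + 1)).Dom), ∀ φ ∈ sp K k X, ∀ p ∈ ball (0 : Pot K k) R,
      ‖A K k t φ X p‖ ≤ Mb * Real.exp (-(κE * (domSys (F.P K) M (k + 1)).dj X)))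
    (hAdmr : ∀ (K k : ℕ) (old : OlderTerms (F.P K) 𝔸 M k), Adm K k old → ‖ρA K k old‖ ≤ r₀)
    (hρ₁ : ∀ (K k : ℕ) (o o' : OlderTerms (F.P K) 𝔸 M k), Adm K k o → Adm K k o' → ∀ (B' : ℝ), 0 ≤ B' →
      (∀ (k' : ℕ) (hk' : k' < k) (Y : (domSys (F.P K) M (k' + 1)).Dom), ∀ φ' ∈ sp K k' Y,
        aw K k (k' + 1) * (Real.exp (κE * (domSys (F.P K) M (k' + 1)).dj Y) * ‖o ⟨k' + 1, Nat.succ_lt_succ hk'⟩ Y φ' - o' ⟨k' + 1, Nat.succ_lt_succ hk'⟩ Y φ'‖) ≤ B') →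
      ‖ρA K k o - ρA K k o'‖ ≤ B')
    (haw : ∀ K k j, 0 ≤ aw K k j) (hawω : ∀ K k j, j ≤ k → aw K k j ≤ cw * ω₁ ^ (k - j)) (hcw : 0 ≤ cw) (hϱ : 0 < ϱ) (hR : r₀ + ϱ < R)
    (hGt : ∀ (K k : ℕ), ∀ t ∈ Ioc (0 : ℝ) θ.γ, ∀ t' ∈ Ioc (0 : ℝ) θ.γ, ∀ (old : OlderTerms (F.P K) 𝔸 M k), Adm K k old → ∀ (X : (domSys (F.P K) M (k + 1)).Dom), ∀ φ ∈ sp K k X,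
      ‖((Gn K) k).E ((t : ℝ) : ℂ) old φ X - ((Gn K) k).E ((t' : ℝ) : ℂ) old φ X‖ ≤ Real.exp (-(κE * (domSys (F.P K) M (k + 1)).dj X)) * (lam K k * |t - t'|))
    (hlam : ∀ K k, lam K k ≤ ℓ₁) (hℓ₁ : 0 ≤ ℓ₁) (hω₁ : 0 ≤ ω₁)
    (Ec : ℕ → ℕ → Type*) [∀ K k, NormedAddCommGroup (Ec K k)] [∀ K k, NormedSpace ℂ (Ec K k)]
    (ι : letI := θ.instVβ₁; letI := θ.instVβ₂
      (K k : ℕ) → (domSys (F.P K) M (k + 1)).Dom → ((Fin (F.P K).d → Site (F.P K) (k + 1) → θ.Vβ) →L[ℝ] Ec K k))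
    (Φ : (K k : ℕ) → (domSys (F.P K) M (k + 1)).Dom → Ec K k → CPair (F.P K) 𝔸)
    (U : (K k : ℕ) → (domSys (F.P K) M (k + 1)).Dom → Set (Ec K k)) (hU : ∀ K k X, IsOpen (U K k X)) (hrU : ∀ K k X, ball (0 : Ec K k) r ⊆ U K k X)
    (hEhol : ∀ g ∈ Window θ.γ, ∀ (K k : ℕ) (X : (domSys (F.P K) M (k + 1)).Dom),
      DifferentiableOn ℂ (fun z => (truncRun K (toClusterTower (Gn K)) k).E (histPrefix g k) (Φ K k X z) X) (U K k X))
    (hΦemb : letI := θ.instVβ₁; letI := θ.instVβ₂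
      ∀ (K k : ℕ) (X : (domSys (F.P K) M (k + 1)).Dom) (Bf : Fin (F.P K).d → Site (F.P K) (k + 1) → θ.Vβ),
        Φ K k X (ι K k X Bf) = emb K k (fun l t => NormedSpace.exp (θ.ρ8 (Bf l t))))
    (hΦsp : ∀ (K k : ℕ) (X : (domSys (F.P K) M (k + 1)).Dom), ∀ z ∈ ball (0 : Ec K k) r, Φ K k X z ∈ sp K k X)
    (w : (K k : ℕ) → (domSys (F.P K) M (k + 1)).Dom → Site (F.P K) (k + 1) → ℝ) (hw₀ : ∀ K k X t, 0 ≤ w K k X t)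
    (hw : letI := θ.instVβ₁; letI := θ.instVβ₂; letI := θ.instιβ
      ∀ (K k : ℕ) (X : (domSys (F.P K) M (k + 1)).Dom) (l : Fin (F.P K).d) (t : Site (F.P K) (k + 1)) (c : θ.ιβ),
        ‖ι K k X (Pi.single l (Pi.single t (θ.bV c)))‖ ≤ w K k X t)
    (htail : ∀ (K k : ℕ) (X : (domSys (F.P K) M (k + 1)).Dom) (t : Site (F.P K) (k + 1)),
      let e : Site (F.P K) (k + 1) → TPt 4 (domCount (F.P K) M (k + 1) * M) := fun x i => (ZMod.cast (x i) : ZMod (domCount (F.P K) M (k + 1) * M))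
      w K k X t ≤ B₃ * Real.exp (-δ₀ * distCT (domCount (F.P K) M (k + 1)) M (e t) (nearT (M := M) (e t) X)))
    (hω₁μ : ω₁ ≤ μ) (hCμ : 4 * Mb * cw / ϱ ≤ μ) (hμω : μ ≤ ℓ.ω) (hℓκ : ℓ.κ ≤ delta1 δ₀ κ ((M : ℝ) * 4))
    (hrow : 16 * B₃ ^ 2 / r ^ 2 * Real.exp (delta1 δ₀ κ ((M : ℝ) * 4) * ((M : ℝ) * 4) * 3) * K₀ (4 * 2 ^ 4) (2 * 4) * K₁ 4 (δ₀ / 2) * ℓ₁ ≤ ℓ.C₉ * ℓ.ω) (k : ℕ) :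
    N22At (u3OfRecord₁₃ θ (objectsOfRecord₁₃ F N θ ℓ) k) :=
  (n22At_u3OfRecord₁₃_objectsOfRecord₁₃_iff F N θ ℓ hs k).2
    (ne9_EA_objectsOfRecord₁₃_of_genAnalyticReadingRoad1Max F N θ ℓ hs hγ hlim m' M hM Gn emb hloc sp hκ₀ hδ₀ hB₃ hr hκE Adm hAdm ρA A hGA hA hMbA hAdmr hρ₁ haw hawω hcw
      hϱ hR hGt hlam hℓ₁ hω₁ Ec ι Φ U hU hrU hEhol hΦemb hΦsp w hw₀ hw htail hω₁μ hCμ hμω hℓκ hrow)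

/-! ## §3 ★★★ The N22 pin face -/

open Classical Finset in
/-- ★★★ **THE N22 PIN FACE ON ROAD 1, MAX CLAUSE**: under K3's node-U3 pin at the tuple (`hpin`), §1's inputs at `θ.toStage13Params` give
`N22At (rateCarriersOfRecord₁₃CoPH 𝔯 F θ hP g₀ os k).u3` for EVERY run length `k`.  LOCATED (hypothesis form); N22 NOT discharged. [folklore] -/
theorem n22At_rateCarriers_of_kernels_pin_of_genAnalyticReadingRoad1Max (𝔯 : RateReading₁₃CoPH N) (θ : Stage13HParams F N) (hP : θ.Provisos₁₃CoPH F N)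
    (g₀ : ℕ → ℝ) (os : List (ULoop F)) (ℓ : U3Letters₁₁) (hs : ℓ.Signs) (hγ : 0 < θ.γ)
    (hpin : (𝔯.lit F θ hP g₀ os).u3 = objectsOfRecord₁₃ F N θ.toStage13Params ℓ) (hlim : PolLimitsExistOfRecord₁₃ F N θ.toStage13Params)
    (m' : ℕ) (M : ℕ) [NeZero M] (hM : M = F.L ^ m')
    (Gn : (K : ℕ) → GenTower (F.P K) 𝔸 M) (emb : ReadingMaps F (MatA N) 𝔸)
    (hloc : Localizes17OfRecord₁₃ F N θ.toStage13Params (fun K => truncRun K (toClusterTower (Gn K))) emb)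
    (sp : (K k : ℕ) → (domSys (F.P K) M (k + 1)).Dom → Set (CPair (F.P K) 𝔸))
    {κ κE δ₀ B₃ r ℓ₁ R r₀ ϱ Mb cw ω₁ μ : ℝ} {lam : ℕ → ℕ → ℝ} {aw : ℕ → ℕ → ℕ → ℝ}
    (hκ₀ : kappa₀ (4 * 2 ^ 4) (2 * 4) ≤ κ / 2) (hδ₀ : 0 < δ₀) (hB₃ : 0 ≤ B₃) (hr : 0 < r) (hκE : κ ≤ κE)
    (Adm : (K k : ℕ) → OlderTerms (F.P K) 𝔸 M k → Prop)
    (hAdm : ∀ K, ∀ g ∈ Window θ.γ, ∀ k, Adm K k (olderOf (recTerm (Gn K) fun n => ((g n : ℝ) : ℂ)) k))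
    {Pot : ℕ → ℕ → Type*} [∀ K k, NormedAddCommGroup (Pot K k)] [∀ K k, NormedSpace ℂ (Pot K k)]
    (ρA : (K k : ℕ) → OlderTerms (F.P K) 𝔸 M k → Pot K k) (A : (K k : ℕ) → ℝ → CPair (F.P K) 𝔸 → (domSys (F.P K) M (k + 1)).Dom → Pot K k → ℂ)
    (hGA : ∀ (K k : ℕ), ∀ t ∈ Ioc (0 : ℝ) θ.γ, ∀ (old : OlderTerms (F.P K) 𝔸 M k), Adm K k old → ∀ (X : (domSys (F.P K) M (k + 1)).Dom), ∀ φ ∈ sp K k X,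
      ((Gn K) k).E ((t : ℝ) : ℂ) old φ X = A K k t φ X (ρA K k old))
    (hA : ∀ (K k : ℕ), ∀ t ∈ Ioc (0 : ℝ) θ.γ, ∀ (X : (domSys (F.P K) M (k + 1)).Dom), ∀ φ ∈ sp K k X, DifferentiableOn ℂ (A K k t φ X) (ball 0 R))
    (hMbA : ∀ (K k : ℕ), ∀ t ∈ Ioc (0 : ℝ) θ.γ, ∀ (X : (domSys (F.P K) M (k + 1)).Dom), ∀ φ ∈ sp K k X, ∀ p ∈ ball (0 : Pot K k) R,
      ‖A K k t φ X p‖ ≤ Mb * Real.exp (-(κE * (domSys (F.P K) M (k + 1)).dj X)))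
    (hAdmr : ∀ (K k : ℕ) (old : OlderTerms (F.P K) 𝔸 M k), Adm K k old → ‖ρA K k old‖ ≤ r₀)
    (hρ₁ : ∀ (K k : ℕ) (o o' : OlderTerms (F.P K) 𝔸 M k), Adm K k o → Adm K k o' → ∀ (B' : ℝ), 0 ≤ B' →
      (∀ (k' : ℕ) (hk' : k' < k) (Y : (domSys (F.P K) M (k' + 1)).Dom), ∀ φ' ∈ sp K k' Y,
        aw K k (k' + 1) * (Real.exp (κE * (domSys (F.P K) M (k' + 1)).dj Y) * ‖o ⟨k' + 1, Nat.succ_lt_succ hk'⟩ Y φ' - o' ⟨k' + 1, Nat.succ_lt_succ hk'⟩ Y φ'‖) ≤ B') →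
      ‖ρA K k o - ρA K k o'‖ ≤ B')
    (haw : ∀ K k j, 0 ≤ aw K k j) (hawω : ∀ K k j, j ≤ k → aw K k j ≤ cw * ω₁ ^ (k - j)) (hcw : 0 ≤ cw) (hϱ : 0 < ϱ) (hR : r₀ + ϱ < R)
    (hGt : ∀ (K k : ℕ), ∀ t ∈ Ioc (0 : ℝ) θ.γ, ∀ t' ∈ Ioc (0 : ℝ) θ.γ, ∀ (old : OlderTerms (F.P K) 𝔸 M k), Adm K k old → ∀ (X : (domSys (F.P K) M (k + 1)).Dom), ∀ φ ∈ sp K k X,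
      ‖((Gn K) k).E ((t : ℝ) : ℂ) old φ X - ((Gn K) k).E ((t' : ℝ) : ℂ) old φ X‖ ≤ Real.exp (-(κE * (domSys (F.P K) M (k + 1)).dj X)) * (lam K k * |t - t'|))
    (hlam : ∀ K k, lam K k ≤ ℓ₁) (hℓ₁ : 0 ≤ ℓ₁) (hω₁ : 0 ≤ ω₁)
    (Ec : ℕ → ℕ → Type*) [∀ K k, NormedAddCommGroup (Ec K k)] [∀ K k, NormedSpace ℂ (Ec K k)]
    (ι : letI := θ.instVβ₁; letI := θ.instVβ₂
      (K k : ℕ) → (domSys (F.P K) M (k + 1)).Dom → ((Fin (F.P K).d → Site (F.P K) (k + 1) → θ.Vβ) →L[ℝ] Ec K k))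
    (Φ : (K k : ℕ) → (domSys (F.P K) M (k + 1)).Dom → Ec K k → CPair (F.P K) 𝔸)
    (U : (K k : ℕ) → (domSys (F.P K) M (k + 1)).Dom → Set (Ec K k)) (hU : ∀ K k X, IsOpen (U K k X)) (hrU : ∀ K k X, ball (0 : Ec K k) r ⊆ U K k X)
    (hEhol : ∀ g ∈ Window θ.γ, ∀ (K k : ℕ) (X : (domSys (F.P K) M (k + 1)).Dom),
      DifferentiableOn ℂ (fun z => (truncRun K (toClusterTower (Gn K)) k).E (histPrefix g k) (Φ K k X z) X) (U K k X))
    (hΦemb : letI := θ.instVβ₁; letI := θ.instVβ₂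
      ∀ (K k : ℕ) (X : (domSys (F.P K) M (k + 1)).Dom) (Bf : Fin (F.P K).d → Site (F.P K) (k + 1) → θ.Vβ),
        Φ K k X (ι K k X Bf) = emb K k (fun l t => NormedSpace.exp (θ.ρ8 (Bf l t))))
    (hΦsp : ∀ (K k : ℕ) (X : (domSys (F.P K) M (k + 1)).Dom), ∀ z ∈ ball (0 : Ec K k) r, Φ K k X z ∈ sp K k X)
    (w : (K k : ℕ) → (domSys (F.P K) M (k + 1)).Dom → Site (F.P K) (k + 1) → ℝ) (hw₀ : ∀ K k X t, 0 ≤ w K k X t)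
    (hw : letI := θ.instVβ₁; letI := θ.instVβ₂; letI := θ.instιβ
      ∀ (K k : ℕ) (X : (domSys (F.P K) M (k + 1)).Dom) (l : Fin (F.P K).d) (t : Site (F.P K) (k + 1)) (c : θ.ιβ),
        ‖ι K k X (Pi.single l (Pi.single t (θ.bV c)))‖ ≤ w K k X t)
    (htail : ∀ (K k : ℕ) (X : (domSys (F.P K) M (k + 1)).Dom) (t : Site (F.P K) (k + 1)),
      let e : Site (F.P K) (k + 1) → TPt 4 (domCount (F.P K) M (k + 1) * M) := fun x i => (ZMod.cast (x i) : ZMod (domCount (F.P K) M (k + 1) * M))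
      w K k X t ≤ B₃ * Real.exp (-δ₀ * distCT (domCount (F.P K) M (k + 1)) M (e t) (nearT (M := M) (e t) X)))
    (hω₁μ : ω₁ ≤ μ) (hCμ : 4 * Mb * cw / ϱ ≤ μ) (hμω : μ ≤ ℓ.ω) (hℓκ : ℓ.κ ≤ delta1 δ₀ κ ((M : ℝ) * 4))
    (hrow : 16 * B₃ ^ 2 / r ^ 2 * Real.exp (delta1 δ₀ κ ((M : ℝ) * 4) * ((M : ℝ) * 4) * 3) * K₀ (4 * 2 ^ 4) (2 * 4) * K₁ 4 (δ₀ / 2) * ℓ₁ ≤ ℓ.C₉ * ℓ.ω) (k : ℕ) :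
    N22At (rateCarriersOfRecord₁₃CoPH 𝔯 F θ hP g₀ os k).u3 :=
  n22At_rateCarriers_of_kernels_pin_of_ne9 𝔯 θ hP g₀ os ℓ hs hpin
    (ne9_EA_objectsOfRecord₁₃_of_genAnalyticReadingRoad1Max F N θ.toStage13Params ℓ hs hγ hlim m' M hM Gn emb hloc sp hκ₀ hδ₀ hB₃ hr hκE Adm hAdm ρA A hGA hA hMbA hAdmr hρ₁ haw hawω hcw
      hϱ hR hGt hlam hℓ₁ hω₁ Ec ι Φ U hU hrU hEhol hΦemb hΦsp w hw₀ hw htail hω₁μ hCμ hμω hℓκ hrow) k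

end YMDAG.N22.KernelFading

end
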